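import Literature.MathematicalPhysics.QuantumManyBody.ThermalExpectation
import HarnessLib

/-!
# Flat modes of nested Dirichlet boxes: `n_{φ_{L'}}(Ψ) = (L/L')³ n_{φ_L}(Ψ)` for `supp Ψ ⊆ Λ_L^N`

Topic `Literature/MathematicalPhysics/QuantumManyBody`, a small companion of
`ThermalExpectation.lean` (the normalised constant mode `boxConstantMode L = L^{-3/2} 1_{Λ_L}` of
the Dirichlet box, LSSY's BEC criterion [LSSY2005, §1.2 (1.19)]
`L⁻³ ∫∫_{Λ×Λ} γ(x, y) dx dy ≥ cN`) and of `BoseEinsteinCondensation.lean` (`occupation`,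
[LSSY2005, §1.2 (1.17)]).

Content (all proved): for `0 < L ≤ L'` the boxes are nested, `Λ_L ⊆ Λ_{L'}` (same corner `0`),
and both flat modes are constant on `Λ_L`, with the ratio `φ_{L'}/φ_L = (L/L')^{3/2}` there. Hence
for an `N`-body wave function `Ψ` supported in `Λ_L^N` the pairings `∫ conj(φ(x)) Ψ(x, Y) dx`
scale by `(L/L')^{3/2}` (`integral_conj_boxConstantMode_mul_of_support`, no integrability
needed), and the occupations `⟨φ, γ_Ψ φ⟩ = N ∫ |∫ conj(φ) Ψ(·, Y)|² dY` by `(L/L')³`: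

* `occupation_boxConstantMode_of_support` — **`n_{φ_{L'}}(Ψ) = (L/L')³ · n_{φ_L}(Ψ)`**.

This is the elementary bookkeeping by which flat-mode condensation of a state is transported to a
larger box at the cost of the volume ratio (crux line `reward-pays-the-wall` of
`AtomisticToContinuum/BoseEinsteinCondensation`).

## References

* [LSSY2005] E. H. Lieb, R. Seiringer, J. P. Solovej, J. Yngvason, *The Mathematics of the Bose Gas
  and its Condensation* (Birkhäuser, 2005), §1.2 (1.17)–(1.19).
-/

noncomputable section

open MeasureTheory
open scoped ENNReal NNReal ComplexConjugate

namespace Literature.MathematicalPhysics.QuantumManyBody.BoseGas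

variable {L L' : ℝ}

/-- The ratio of the flat-mode constants of nested boxes:
`(√(L'³))⁻¹ = √((L/L')³) · (√(L³))⁻¹` for `0 < L`, `0 < L'`. [folklore] -/
theorem inv_sqrt_cube_eq_mul (hL : 0 < L) (hL' : 0 < L') :
    (Real.sqrt (L' ^ 3))⁻¹ = Real.sqrt ((L / L') ^ 3) * (Real.sqrt (L ^ 3))⁻¹ := by
  have hsL : Real.sqrt (L ^ 3) ≠ 0 := (Real.sqrt_pos.2 (by positivity)).ne'
  have hsL' : Real.sqrt (L' ^ 3) ≠ 0 := (Real.sqrt_pos.2 (by positivity)).ne'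
  rw [div_pow, Real.sqrt_div (by positivity : (0 : ℝ) ≤ L ^ 3)]
  field_simp

/-- On the support the two flat modes are proportional:
`conj(φ_{L'}(x)) Ψ(x, Y) = √((L/L')³) · conj(φ_L(x)) Ψ(x, Y)` for every `x`, whenever `Ψ` is
supported in `Λ_L^{n+1}` and `0 < L ≤ L'`. [folklore] -/
theorem conj_boxConstantMode_mul_of_support {n : ℕ} (hL : 0 < L) (hLL' : L ≤ L')
    (Ψ : Config (n + 1) → ℂ) (hΨ : ∀ X, Ψ X ≠ 0 → ∀ i, X i ∈ box L) (Y : Config n) (x : Space) :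
    conj (boxConstantMode L' x) * Ψ (Matrix.vecCons x Y) =
      (Real.sqrt ((L / L') ^ 3) : ℂ) * (conj (boxConstantMode L x) * Ψ (Matrix.vecCons x Y)) := by
  by_cases h0 : Ψ (Matrix.vecCons x Y) = 0
  · simp [h0]
  · have hx : x ∈ box L := by simpa using hΨ _ h0 0
    have hx' : x ∈ box L' := fun k => ⟨(hx k).1, (hx k).2.trans_le hLL'⟩
    rw [boxConstantMode, boxConstantMode, Set.indicator_of_mem hx', Set.indicator_of_mem hx,
      ← mul_assoc]
    congr 1
    rw [← Complex.ofReal_inv, ← Complex.ofReal_inv, Complex.conj_ofReal, Complex.conj_ofReal,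
      ← Complex.ofReal_mul, inv_sqrt_cube_eq_mul hL (hL.trans_le hLL')]

/-- The pairings scale: `∫ conj(φ_{L'}) Ψ(·, Y) = √((L/L')³) ∫ conj(φ_L) Ψ(·, Y)` (no
integrability needed). [folklore] -/
theorem integral_conj_boxConstantMode_mul_of_support {n : ℕ} (hL : 0 < L) (hLL' : L ≤ L')
    (Ψ : Config (n + 1) → ℂ) (hΨ : ∀ X, Ψ X ≠ 0 → ∀ i, X i ∈ box L) (Y : Config n) :
    ∫ x, conj (boxConstantMode L' x) * Ψ (Matrix.vecCons x Y) =
      (Real.sqrt ((L / L') ^ 3) : ℂ) * ∫ x, conj (boxConstantMode L x) * Ψ (Matrix.vecCons x Y) := by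
  rw [← integral_const_mul]
  exact integral_congr_ae (Filter.Eventually.of_forall fun x =>
    conj_boxConstantMode_mul_of_support hL hLL' Ψ hΨ Y x)

/-- `‖√r‖² = r` in `ℝ≥0∞` for `r ≥ 0` (complex cast). [folklore] -/
theorem ennnorm_ofReal_sqrt_sq {r : ℝ} (hr : 0 ≤ r) :
    ((‖(Real.sqrt r : ℂ)‖₊ : ℝ≥0∞)) ^ 2 = ENNReal.ofReal r := by
  rw [← ENNReal.coe_pow, ENNReal.ofReal, ENNReal.coe_inj]
  ext
  rw [NNReal.coe_pow, coe_nnnorm, Complex.norm_real, Real.norm_of_nonneg (Real.sqrt_nonneg _),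
    Real.sq_sqrt hr, Real.coe_toNNReal _ hr]

/-- **Flat modes of nested boxes.** A wave function supported in `Λ_L^N`, `0 < L ≤ L'`, has
`n_{φ_{L'}}(Ψ) = (L/L')³ n_{φ_L}(Ψ)` for the flat modes `φ_L = L^{-3/2} 1_{Λ_L}`
(`boxConstantMode`): both modes are constant on the support, with ratio `(L/L')^{3/2}`.
[cite: LSSY2005, §1.2 (1.17)–(1.19)] -/
theorem occupation_boxConstantMode_of_support {N : ℕ} {L L' : ℝ} (hL : 0 < L) (hLL' : L ≤ L')
    (Ψ : Config N → ℂ) (hΨ : ∀ X, Ψ X ≠ 0 → ∀ i, X i ∈ box L) :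
    occupation N (boxConstantMode L') Ψ =
      ENNReal.ofReal ((L / L') ^ 3) * occupation N (boxConstantMode L) Ψ := by
  cases N with
  | zero => simp [occupation]
  | succ n =>
    have hr : (0 : ℝ) ≤ (L / L') ^ 3 := by
      have : 0 ≤ L / L' := div_nonneg hL.le (hL.le.trans hLL')
      positivity
    simp only [occupation]
    rw [mul_left_comm, ← lintegral_const_mul' _ _ ENNReal.ofReal_ne_top]
    congr 1
    refine lintegral_congr fun Y => ?_
    rw [integral_conj_boxConstantMode_mul_of_support hL hLL' Ψ hΨ Y, nnnorm_mul, ENNReal.coe_mul,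
      mul_pow, ennnorm_ofReal_sqrt_sq hr]

end Literature.MathematicalPhysics.QuantumManyBody.BoseGas

end
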